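import Summits.CriticalPhenomena.SAWScalingLimit.Theorems.SAWTotalPositivityTPToTraversalBoundChainTransfer

/-!
# Clean kernel contraction for `TPToTraversalBound` — helper file (trivial regimes)

Crux `SAWTotalPositivity.TPToTraversalBound` (stmt-CriticalPhenomena-10687), line `radial-portal-transfer`,
stub `stub_cleanContraction : CleanContraction` (the ENGINE of the line: clean kernel contraction for
undecorated multi-strand states of the ratio-4 clean square annulus; sized OPEN by the planner).

This file proves the honest trivial regimes of `CleanContraction` used by the reduction
`cleanContraction_of_core` (work file of the stub):

* `HasPieces.lt_of_lt` — consecutive listed maximal outside pieces are separated by a vertex of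
  the open box;
* `HasPieces.le_sq_succ` — a SAW has at most `(2N-1)² + 1` maximal pieces outside the open box
  `B_∞(c, N)` (the separating box vertices are distinct and the open box has `(2N-1)²` sites), so
  the heaviness event `HasPieces γ c N N j` is EMPTY for `j > (2N-1)² + 1`
  (`law_sep_hasPieces_eq_zero`);
* `HasPieces.le_eight_mul_succ` — the linear bound: at most `8N + 1` pieces (the last vertex of
  each piece but the last lies on the layer `supDist = N`, `8N` sites), so only `j = O(N)` targets
  and `m = O(N)` strands matter (`law_sep_hasPieces_eq_zero'`);
* `HasPieces.le_one_of_loop` — a SAW from `u` to `u` is trivial, hence has at most one piece;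
* `CleanContractionCore` — the RESIDUAL statement: `CleanContraction` restricted to the only
  non-trivial regime `N ≥ N₀` (any fixed `N₀`; and `N ≥ 2`), `u ≠ v`,
  `θ m + m₀ ≤ j ≤ min((2N-1)² + 1, 8N + 1)`, `m ≤ 2j` (same vocabulary, nothing asserted), and the
  proved reduction `cleanContraction_of_core : CleanContractionCore → CleanContraction` (enlarge `θ`
  to `max θ (1/2)`, `m₀` to `max m₀ (8N₀ + 3)`).
-/

noncomputable section

open MeasureTheory Filter Topology Set Metric
open scoped NNReal ENNReal
open Literature.Probability.LatticeModels
open Literature.Probability.RandomPlanarGeometry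
open Literature.Probability.RandomPlanarGeometry.SAW
open Summit.CriticalPhenomena.SAWScalingLimit.Theses.SAWTotalPositivity

namespace Summit.CriticalPhenomena.SAWScalingLimit.Theorems.TPToTraversalBound.Radial

variable {Ω : Set ℂ} {δ : ℝ} {u v : Site 2}

/-! ## Listed pieces are separated by box vertices -/

/-- In a list of maximal outside pieces with increasing starting indices, each piece ends strictly
before the next one starts (overlapping maximal pieces coincide). [folklore] -/
theorem HasPieces.lt_of_lt {γ : DomainSAW Ω δ u v} {c : Site 2} {N m : ℕ} {i j : Fin m → ℕ}
    (hi : StrictMono i) (hp : ∀ k, IsOutsidePiece γ c N (i k) (j k)) {k₁ k₂ : Fin m}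
    (hlt : k₁ < k₂) : j k₁ < i k₂ := by
  have hii : i k₁ < i k₂ := hi hlt
  by_contra hle
  push Not at hle
  have := (hp k₁).eq_of_mem (hp k₂) (q := i k₂) ⟨hii.le, hle⟩ ⟨le_rfl, (hp k₂).1⟩
  exact absurd this.1 hii.ne

/-- The vertex right after a listed piece which is not the last one is a vertex of the open box
(right-maximality; the walk does not end there since a further piece follows). [folklore] -/
theorem HasPieces.inOpenBox_succ {γ : DomainSAW Ω δ u v} {c : Site 2} {N m : ℕ} {i j : Fin m → ℕ}
    (hi : StrictMono i) (hp : ∀ k, IsOutsidePiece γ c N (i k) (j k)) {k₁ k₂ : Fin m}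
    (hlt : k₁ < k₂) :
    j k₁ + 1 ≤ γ.walk.length ∧ InOpenBox c N (γ.walk.getVert (j k₁ + 1)) := by
  have h1 := HasPieces.lt_of_lt hi hp hlt
  have h2 : i k₂ ≤ γ.walk.length := (hp k₂).1.trans (hp k₂).2.1
  refine ⟨by omega, ?_⟩
  rcases (hp k₁).2.2.2.2 with h0 | hbox
  · omega
  · exact hbox

/-! ## At most `(2N-1)² + 1` pieces -/

/-- The open lattice box of half-side `N` about `c`, as a finite set of coordinate pairs, has
`(2N-1)²` points and contains the coordinates of every site of the open box. [folklore] -/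
theorem inOpenBox_mem_Icc {c : Site 2} {N : ℕ} {w : Site 2} (hw : InOpenBox c N w) :
    (w 0, w 1) ∈ (Finset.Icc (c 0 - ((N : ℤ) - 1)) (c 0 + ((N : ℤ) - 1))) ×ˢ
      (Finset.Icc (c 1 - ((N : ℤ) - 1)) (c 1 + ((N : ℤ) - 1))) := by
  have h : supDist w c < N := hw
  have h0 := abs_sub_le_supDist w c 0
  have h1 := abs_sub_le_supDist w c 1
  rw [abs_le] at h0 h1
  simp only [Finset.mem_product, Finset.mem_Icc]
  omega

/-- **At most `(2N-1)² + 1` maximal outside pieces.** The vertices right after the listed pieces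
(all but the last) are distinct vertices of the open box `B_∞(c, N)`, which has `(2N-1)²` sites;
in particular the heaviness event `HasPieces γ c N N j` is empty for `j > (2N-1)² + 1`.
[folklore] -/
theorem HasPieces.le_sq_succ {γ : DomainSAW Ω δ u v} {c : Site 2} {N d m : ℕ}
    (h : HasPieces γ c N d m) : m ≤ (2 * N - 1) ^ 2 + 1 := by
  classical
  obtain ⟨i, j, hi, hk⟩ := h
  have hp : ∀ k, IsOutsidePiece γ c N (i k) (j k) := fun k => (hk k).1
  rcases Nat.lt_or_ge m 2 with hm | hm
  · omega
  -- the last index and the embedding of `Fin (m-1)`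
  set last : Fin m := ⟨m - 1, by omega⟩ with hlast
  set emb : Fin (m - 1) → Fin m := Fin.castLE (Nat.sub_le m 1) with hemb
  have hemb_lt : ∀ k, emb k < last := fun k => by
    rw [hlast, Fin.lt_def]
    simp [hemb]
  set B : Finset (ℤ × ℤ) := (Finset.Icc (c 0 - ((N : ℤ) - 1)) (c 0 + ((N : ℤ) - 1))) ×ˢ
      (Finset.Icc (c 1 - ((N : ℤ) - 1)) (c 1 + ((N : ℤ) - 1))) with hB
  set f : Fin (m - 1) → ℤ × ℤ := fun k =>
    ((γ.walk.getVert (j (emb k) + 1)) 0, (γ.walk.getVert (j (emb k) + 1)) 1) with hf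
  have hf_mem : ∀ k ∈ (Finset.univ : Finset (Fin (m - 1))), f k ∈ B := fun k _ =>
    inOpenBox_mem_Icc (HasPieces.inOpenBox_succ hi hp (hemb_lt k)).2
  have hf_inj : Set.InjOn f (Finset.univ : Finset (Fin (m - 1))) := by
    intro k₁ _ k₂ _ heq
    simp only [hf, Prod.mk.injEq] at heq
    have hw : γ.walk.getVert (j (emb k₁) + 1) = γ.walk.getVert (j (emb k₂) + 1) := by
      funext t
      fin_cases t
      · exact heq.1
      · exact heq.2
    have hl₁ := (HasPieces.inOpenBox_succ hi hp (hemb_lt k₁)).1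
    have hl₂ := (HasPieces.inOpenBox_succ hi hp (hemb_lt k₂)).1
    have hidx : j (emb k₁) + 1 = j (emb k₂) + 1 := γ.isPath.getVert_injOn hl₁ hl₂ hw
    by_contra hne
    rcases lt_or_gt_of_ne hne with hlt | hlt
    · have h1 := HasPieces.lt_of_lt hi hp (k₁ := emb k₁) (k₂ := emb k₂)
        (Fin.strictMono_castLE _ hlt)
      have h2 := (hp (emb k₂)).1
      omega
    · have h1 := HasPieces.lt_of_lt hi hp (k₁ := emb k₂) (k₂ := emb k₁)
        (Fin.strictMono_castLE _ hlt)
      have h2 := (hp (emb k₁)).1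
      omega
  have hcard := Finset.card_le_card_of_injOn f hf_mem hf_inj
  rw [Finset.card_univ, Fintype.card_fin] at hcard
  have hBcard : B.card = (2 * N - 1) * (2 * N - 1) := by
    rw [hB, Finset.card_product, Int.card_Icc, Int.card_Icc]
    have h0 : (c 0 + ((N : ℤ) - 1) + 1 - (c 0 - ((N : ℤ) - 1))).toNat = 2 * N - 1 := by omega
    have h1 : (c 1 + ((N : ℤ) - 1) + 1 - (c 1 - ((N : ℤ) - 1))).toNat = 2 * N - 1 := by omega
    rw [h0, h1]
  rw [hBcard, ← pow_two] at hcard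
  omega

/-- **Trivial regime `j > (2N-1)² + 1`**: the heaviness event (intersected with anything, e.g. an
atom of the outside configuration) is empty, so its law vanishes. [folklore] -/
theorem law_sep_hasPieces_eq_zero (P : DomainSAW Ω δ u v → Prop) {c : Site 2} {N d j : ℕ}
    (hj : (2 * N - 1) ^ 2 + 1 < j) :
    law Ω δ u v {γ | P γ ∧ HasPieces γ c N d j} = 0 := by
  have : {γ : DomainSAW Ω δ u v | P γ ∧ HasPieces γ c N d j} = ∅ := by
    ext γ
    simp only [Set.mem_setOf_eq, Set.mem_empty_iff_false, iff_false, not_and]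
    intro _ h
    have := h.le_sq_succ
    omega
  rw [this, measure_empty]

/-! ## At most `8N + 1` pieces (linear bound) -/

/-- A site at sup-distance exactly `N` from `c` has its coordinates in the square ring
`[c-N, c+N]² \ [c-N+1, c+N-1]²`. [folklore] -/
theorem supDist_eq_mem_ring {c : Site 2} {N : ℕ} {w : Site 2} (hle : supDist w c ≤ N)
    (hge : ¬ InOpenBox c N w) :
    (w 0, w 1) ∈ ((Finset.Icc (c 0 - (N : ℤ)) (c 0 + (N : ℤ))) ×ˢ
        (Finset.Icc (c 1 - (N : ℤ)) (c 1 + (N : ℤ)))) \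
      ((Finset.Icc (c 0 - ((N : ℤ) - 1)) (c 0 + ((N : ℤ) - 1))) ×ˢ
        (Finset.Icc (c 1 - ((N : ℤ) - 1)) (c 1 + ((N : ℤ) - 1)))) := by
  have hge' : ¬ supDist w c < N := hge
  have h0 := abs_sub_le_supDist w c 0
  have h1 := abs_sub_le_supDist w c 1
  rw [abs_le] at h0 h1
  simp only [Finset.mem_sdiff, Finset.mem_product, Finset.mem_Icc, not_and_or]
  refine ⟨by omega, ?_⟩
  by_contra hcon
  push Not at hcon
  apply hge'
  have : supDist w c ≤ (N : ℤ) - 1 := by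
    refine max_le ?_ ?_ <;> rw [abs_le] <;> omega
  omega

/-- The square ring has `8N` sites (`(2N+1)² - (2N-1)²`, for `N ≥ 1`). [folklore] -/
theorem card_ring_eq (c : Site 2) {N : ℕ} (hN : 1 ≤ N) :
    (((Finset.Icc (c 0 - (N : ℤ)) (c 0 + (N : ℤ))) ×ˢ
        (Finset.Icc (c 1 - (N : ℤ)) (c 1 + (N : ℤ)))) \
      ((Finset.Icc (c 0 - ((N : ℤ) - 1)) (c 0 + ((N : ℤ) - 1))) ×ˢ
        (Finset.Icc (c 1 - ((N : ℤ) - 1)) (c 1 + ((N : ℤ) - 1))))).card = 8 * N := by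
  rw [Finset.card_sdiff_of_subset]
  · rw [Finset.card_product, Finset.card_product, Int.card_Icc, Int.card_Icc, Int.card_Icc,
      Int.card_Icc]
    have h0 : (c 0 + (N : ℤ) + 1 - (c 0 - (N : ℤ))).toNat = 2 * N + 1 := by omega
    have h1 : (c 1 + (N : ℤ) + 1 - (c 1 - (N : ℤ))).toNat = 2 * N + 1 := by omega
    have h2 : (c 0 + ((N : ℤ) - 1) + 1 - (c 0 - ((N : ℤ) - 1))).toNat = 2 * N - 1 := by omega
    have h3 : (c 1 + ((N : ℤ) - 1) + 1 - (c 1 - ((N : ℤ) - 1))).toNat = 2 * N - 1 := by omega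
    rw [h0, h1, h2, h3]
    obtain ⟨k, rfl⟩ : ∃ k, N = k + 1 := ⟨N - 1, by omega⟩
    have : 2 * (k + 1) - 1 = 2 * k + 1 := by omega
    rw [this]
    ring_nf
    omega
  · intro p hp
    simp only [Finset.mem_product, Finset.mem_Icc] at hp ⊢
    omega

/-- **At most `8N + 1` maximal outside pieces.** The LAST vertex of every listed piece but the
last one lies outside the open box and next (along the walk) to a box vertex, hence on the layer
`supDist = N`, which has `8N` sites; these vertices are distinct. So `HasPieces γ c N d j` is empty
for `j > 8N + 1`: in the clean contraction only `j = O(N)` (hence `m = O(N)` strands) matter.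
[folklore] -/
theorem HasPieces.le_eight_mul_succ {γ : DomainSAW Ω δ u v} {c : Site 2} {N d m : ℕ}
    (h : HasPieces γ c N d m) : m ≤ 8 * N + 1 := by
  classical
  obtain ⟨i, j, hi, hk⟩ := h
  have hp : ∀ k, IsOutsidePiece γ c N (i k) (j k) := fun k => (hk k).1
  rcases Nat.lt_or_ge m 2 with hm | hm
  · omega
  set last : Fin m := ⟨m - 1, by omega⟩ with hlast
  set emb : Fin (m - 1) → Fin m := Fin.castLE (Nat.sub_le m 1) with hemb
  have hemb_lt : ∀ k, emb k < last := fun k => by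
    rw [hlast, Fin.lt_def]
    simp [hemb]
  -- the box is not empty: `N ≥ 1`
  have hN : 1 ≤ N := by
    obtain ⟨k0⟩ : Nonempty (Fin (m - 1)) := ⟨⟨0, by omega⟩⟩
    have hin : supDist (γ.walk.getVert (j (emb k0) + 1)) c < N :=
      (HasPieces.inOpenBox_succ hi hp (hemb_lt k0)).2
    have := supDist_nonneg (γ.walk.getVert (j (emb k0) + 1)) c
    omega
  set R : Finset (ℤ × ℤ) := (((Finset.Icc (c 0 - (N : ℤ)) (c 0 + (N : ℤ))) ×ˢ
        (Finset.Icc (c 1 - (N : ℤ)) (c 1 + (N : ℤ)))) \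
      ((Finset.Icc (c 0 - ((N : ℤ) - 1)) (c 0 + ((N : ℤ) - 1))) ×ˢ
        (Finset.Icc (c 1 - ((N : ℤ) - 1)) (c 1 + ((N : ℤ) - 1))))) with hR
  set f : Fin (m - 1) → ℤ × ℤ := fun k =>
    ((γ.walk.getVert (j (emb k))) 0, (γ.walk.getVert (j (emb k))) 1) with hf
  have hf_mem : ∀ k ∈ (Finset.univ : Finset (Fin (m - 1))), f k ∈ R := by
    intro k _
    obtain ⟨hl, hin⟩ := HasPieces.inOpenBox_succ hi hp (hemb_lt k)
    have hout : ¬ InOpenBox c N (γ.walk.getVert (j (emb k))) :=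
      (hp (emb k)).2.2.1 _ (hp (emb k)).1 le_rfl
    have hle : supDist (γ.walk.getVert (j (emb k))) c ≤ N :=
      supDist_le_of_inOpenBox_succ γ (by omega) hin
    exact supDist_eq_mem_ring hle hout
  have hf_inj : Set.InjOn f (Finset.univ : Finset (Fin (m - 1))) := by
    intro k₁ _ k₂ _ heq
    simp only [hf, Prod.mk.injEq] at heq
    have hw : γ.walk.getVert (j (emb k₁)) = γ.walk.getVert (j (emb k₂)) := by
      funext t
      fin_cases t
      · exact heq.1
      · exact heq.2
    have hl₁ : j (emb k₁) ≤ γ.walk.length := (hp (emb k₁)).2.1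
    have hl₂ : j (emb k₂) ≤ γ.walk.length := (hp (emb k₂)).2.1
    have hidx : j (emb k₁) = j (emb k₂) := γ.isPath.getVert_injOn hl₁ hl₂ hw
    by_contra hne
    rcases lt_or_gt_of_ne hne with hlt | hlt
    · have h1 := HasPieces.lt_of_lt hi hp (k₁ := emb k₁) (k₂ := emb k₂)
        (Fin.strictMono_castLE _ hlt)
      have h2 := (hp (emb k₂)).1
      omega
    · have h1 := HasPieces.lt_of_lt hi hp (k₁ := emb k₂) (k₂ := emb k₁)
        (Fin.strictMono_castLE _ hlt)
      have h2 := (hp (emb k₁)).1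
      omega
  have hcard := Finset.card_le_card_of_injOn f hf_mem hf_inj
  rw [Finset.card_univ, Fintype.card_fin, hR, card_ring_eq c hN] at hcard
  omega

/-- **Trivial regime `j > 8N + 1`**: the heaviness event is empty, its law vanishes. [folklore] -/
theorem law_sep_hasPieces_eq_zero' (P : DomainSAW Ω δ u v → Prop) {c : Site 2} {N d j : ℕ}
    (hj : 8 * N + 1 < j) :
    law Ω δ u v {γ | P γ ∧ HasPieces γ c N d j} = 0 := by
  have : {γ : DomainSAW Ω δ u v | P γ ∧ HasPieces γ c N d j} = ∅ := by
    ext γ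
    simp only [Set.mem_setOf_eq, Set.mem_empty_iff_false, iff_false, not_and]
    intro _ h
    have := h.le_eight_mul_succ
    omega
  rw [this, measure_empty]

/-! ## Loops are trivial -/

/-- A SAW from `u` to `u` is the trivial walk, so it has at most one maximal outside piece.
[folklore] -/
theorem HasPieces.le_one_of_loop {γ : DomainSAW Ω δ u u} {c : Site 2} {N d m : ℕ}
    (h : HasPieces γ c N d m) : m ≤ 1 := by
  have h1 := h.le_length_succ
  have h3 : γ.walk.length = 0 :=
    SimpleGraph.Walk.length_eq_zero_iff.2 (SimpleGraph.Walk.isPath_iff_nil.1 γ.isPath)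
  omega

/-- **Trivial regime `u = v`**: for `j ≥ 2` the heaviness event of SAWs from `u` to `u` is empty.
[folklore] -/
theorem law_sep_hasPieces_eq_zero_of_loop (P : DomainSAW Ω δ u u → Prop) {c : Site 2}
    {N d j : ℕ} (hj : 2 ≤ j) :
    law Ω δ u u {γ | P γ ∧ HasPieces γ c N d j} = 0 := by
  have : {γ : DomainSAW Ω δ u u | P γ ∧ HasPieces γ c N d j} = ∅ := by
    ext γ
    simp only [Set.mem_setOf_eq, Set.mem_empty_iff_false, iff_false, not_and]
    intro _ h
    have := h.le_one_of_loop
    omega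
  rw [this, measure_empty]

/-! ## The residual statement and the reduction -/

/-- **Residual clean kernel contraction** (the non-trivial regime of `CleanContraction`, same
objects). As `CleanContraction`, but only ASYMPTOTICALLY in the box size — the data are restricted
to `N ≥ N₀` for an `N₀` of the prover's choice (and `N ≥ 2`) — with distinct endpoints
`u ≠ v`, targets `j ≤ min((2N-1)² + 1, 8N + 1)` (otherwise the heaviness event is empty,
`HasPieces.le_sq_succ`, `HasPieces.le_eight_mul_succ`) and outside configurations with `m ≤ 2j`
maximal pieces (a free normalisation: any admissible `θ` may be enlarged to `max θ (1/2)`), so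
that only `m ≤ 16N + 2` strands ever matter. By `cleanContraction_of_core`
this statement implies `CleanContraction`; it is the multi-strand crossing estimate for critical
square-lattice SAW in ONE clean shape (the ratio-4 square annulus, `O(N)` vertex-disjoint strands of
the full open `(8N-1)`-box with weight `x_c^{total length}`, portals pinned by `E₀ = outEdgeSet γ₀`,
inner pairing ranging over the non-crossing pairings for which `E₀ ∪ strands` is one `u-v` path):
an unforced big piece outside the inner box should cost a uniform factor. Nothing is asserted
here. -/
def CleanContractionCore : Prop :=
  ∃ (N₀ : ℕ) (θ lam C : ℝ) (m₀ : ℕ), θ < 1 ∧ 0 < lam ∧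
    ∀ (Ω : Set ℂ) (δ : ℝ) (u v c : Site 2) (N m j : ℕ) (γ₀ : DomainSAW Ω δ u v),
      Bornology.IsBounded Ω → 0 < δ → N₀ ≤ N → 2 ≤ N → closedBox δ c (4 * N) ⊆ Ω → u ≠ v →
      ¬ HasPieces γ₀ c (4 * N) 0 (m + 1) → θ * m + m₀ ≤ (j : ℝ) →
      j ≤ (2 * N - 1) ^ 2 + 1 → j ≤ 8 * N + 1 → m ≤ 2 * j →
      law Ω δ u v {γ | outEdgeSet γ c (4 * N) = outEdgeSet γ₀ c (4 * N) ∧ HasPieces γ c N N j}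
        ≤ ENNReal.ofReal (C * 2 ^ (-(lam * j))) *
          law Ω δ u v {γ | outEdgeSet γ c (4 * N) = outEdgeSet γ₀ c (4 * N)}

/-- **Reduction: the residual statement implies `CleanContraction`.** With
`θ' = max θ (1/2) < 1` and `m₀' = max m₀ (8N₀ + 3)` every admissible target satisfies
`j ≥ 8N₀ + 3 ≥ 3` and `m ≤ 2j`; if `j > (2N-1)² + 1` or `j > 8N + 1` (in particular whenever
`N < N₀ + 1`) the event is empty (`law_sep_hasPieces_eq_zero`, `law_sep_hasPieces_eq_zero'`); if
`u = v` the only SAW is trivial and the event is empty for `j ≥ 2`; `N ≤ 1` forces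
`j ≤ (2N-1)² + 1 ≤ 2 < 3`; the remaining data are exactly those of `CleanContractionCore`.
[folklore] -/
theorem cleanContraction_of_core : CleanContractionCore → CleanContraction := by
  intro h
  obtain ⟨N₀, θ, lam, C, m₀, hθ, hlam, H⟩ := h
  refine ⟨max θ (1 / 2), lam, C, max m₀ (8 * N₀ + 3), max_lt hθ (by norm_num), hlam, ?_⟩
  intro Ω δ u v c N m j γ₀ hΩ hδ hN hbox hm hj
  have hm0 : (0 : ℝ) ≤ m := Nat.cast_nonneg _
  have hθ' : (1 / 2 : ℝ) * m ≤ max θ (1 / 2) * m :=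
    mul_le_mul_of_nonneg_right (le_max_right _ _) hm0
  have hm₀' : ((8 * N₀ + 3 : ℕ) : ℝ) ≤ ((max m₀ (8 * N₀ + 3) : ℕ) : ℝ) := by
    exact_mod_cast le_max_right m₀ _
  have hm₀ : (m₀ : ℝ) ≤ ((max m₀ (8 * N₀ + 3) : ℕ) : ℝ) := by exact_mod_cast le_max_left m₀ _
  have hjN₀ : 8 * N₀ + 3 ≤ j := by
    have : ((8 * N₀ + 3 : ℕ) : ℝ) ≤ j := by nlinarith
    exact_mod_cast this
  have hmj : m ≤ 2 * j := by
    have h8 : (0 : ℝ) ≤ ((8 * N₀ + 3 : ℕ) : ℝ) := Nat.cast_nonneg _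
    have : (m : ℝ) ≤ 2 * j := by nlinarith
    exact_mod_cast this
  have hjθ : θ * m + m₀ ≤ (j : ℝ) := by
    have h1 : θ * m ≤ max θ (1 / 2) * m := mul_le_mul_of_nonneg_right (le_max_left _ _) hm0
    linarith
  by_cases hjN : (2 * N - 1) ^ 2 + 1 < j
  · rw [law_sep_hasPieces_eq_zero _ hjN]
    exact zero_le
  push Not at hjN
  by_cases hjN' : 8 * N + 1 < j
  · rw [law_sep_hasPieces_eq_zero' _ hjN']
    exact zero_le
  push Not at hjN'
  by_cases huv : u = v
  · subst huv
    rw [law_sep_hasPieces_eq_zero_of_loop _ (by omega)]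
    exact zero_le
  have hNN₀ : N₀ ≤ N := by omega
  have hN2 : 2 ≤ N := by
    by_contra hlt
    interval_cases N
    all_goals (norm_num at hjN; omega)
  exact H Ω δ u v c N m j γ₀ hΩ hδ hNN₀ hN2 hbox huv hm hjθ hjN hjN' hmj

end Summit.CriticalPhenomena.SAWScalingLimit.Theorems.TPToTraversalBound.Radial

end
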